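import Literature.Analysis.FluidPDE.UlocCubicInterpolation
import HarnessLib

/-!
# Weak–strong uniqueness for local Leray solutions (Lemarié-Rieusset 2016, Thm. 14.7):
the assembly of the difference estimate **U₁** from the per-ball inequality

Analysis/FluidPDE proof file (theorems only, everything PROVED, no definitions, no named facts)
on the inline proof path of the named fact
`Literature.Analysis.FluidPDE.local_leray_difference_energy_estimate` (**U₁**,
`LocalLerayWeakStrongProofs.lean`; P. G. Lemarié-Rieusset, *The Navier–Stokes Problem in the
21st Century* (2016), proof of **Thm. 14.7**, held copy file pp. 515–518), step 5 ("assemble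
the display") of the proof plan recorded in the module docstring of that file.

The printed proof reaches the display "`max(α(t)², νγ(t)²) ≤ …`" (top of p. 518) from the
local energy inequality for `w = u₁ - u₂` tested with the translates `φ = φ₀(· - x₀)` of a bump
and the seven estimates of its right-hand side (p. 517, "we find … while …": absolute constants
times `ν∫₀ᵗα²`, `δ(t)³` (twice), `∫₀ᵗ‖u₃‖_∞α²`, `‖u₄‖γ(γ² + ∫₀ᵗα²)^{1/2}`, `‖u₄‖(γ² + ∫₀ᵗα²)`,
`γ(∫₀ᵗ‖u₃‖²_∞α²)^{1/2}`) in two elementary moves: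

1. (p. 517, "Writing `δ(t)² ≤ C(∫₀ᵗα² + γ(t)(∫₀ᵗα⁶)^{1/6})`") the interpolation of the cubic
   quantity `δ(t) = ‖w‖_{(L³L³)_uloc((0,t)×ℝ³)}` by `α = ‖w‖_{L²_uloc}` and
   `γ(t) = ‖∇ ⊗ w‖_{(L²L²)_uloc}` — in the correct form with the lower-order term `∫₀ᵗα³` (the
   book's own p. 494; see the docstring of **U₁**), proved in the tree as
   `exists_lintegral_cylinder_cube_le` (`UlocCubicInterpolation.lean`, already in Young form);
2. (pp. 517–518) Young's inequality "for every `η > 0`, with constants that do not depend on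
   `η`", and the passage from the bumps `φ_{x₀}` to the suprema over `x₀`.

This file **proves these two moves** for the tree's objects, as a theorem whose hypothesis is
the per-ball inequality — the sum of the seven printed estimates, i.e. the first line of the
display "we obtain" on p. 517 before the interpolation of `δ(t)³`, for every centre `x₀` and
a.e. `t`, with one absolute constant `C` — and whose conclusion is the display of **U₁** with
its two constants (`C₁ = C + 1` absolute in front of the `‖u₄‖`-terms, `C₂ < ∞` depending on
the data through the a priori bound `α² ≤ M` and `ν`):

* `exists_ae_max_ulocEnergy_le_of_forall_ball_le` — for two local Leray solutions `u₁, u₂` on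
  the slab with weak spatial gradients `G₁, G₂`: if for every `x₀` and a.e. `t ∈ (0,T)`
  `∫_{B(x₀,1)}|w(t)|² + ν∫₀ᵗ∫_{B(x₀,1)}|G₁ - G₂|² ≤ C(ν∫₀ᵗα² + δ(t)³ + ∫₀ᵗ m α²`
  `+ γ(t)(∫₀ᵗ m²α²)^{1/2} + ε(∫₀ᵗα² + γ(t)²))`, then there is `C₂ < ∞` such that for every
  `η > 0` and a.e. `t ∈ (0,T)` the display of **U₁** holds;
* `local_leray_difference_energy_estimate_of_forall_ball` — the same at the level of the named
  fact: **U₁** follows from the per-ball inequality asserted for all data of **U₁** with one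
  absolute constant (the form in which steps 1–4 of the proof plan deliver it).

Ingredients proved here: the passage from the centres of a dense sequence (where an a.e.-in-`t`
statement is available simultaneously) to every centre, by inner regularity of balls
(`lintegral_ball_add_le_of_denseSeq`: exhaust `B(x₀,1)` by smaller concentric balls, each inside
a ball of the sequence; `MeasureTheory.setLIntegral_iUnion_of_directed`, no measurability), and
the bookkeeping: the cubic term is `≤ K∫₀ᵗα³ + ηγ² + K⁴η⁻³∫₀ᵗα⁶` on every unit cylinder, the
lower-order term is absorbed through `α² ≤ M` a.e. (`exists_ae_ulocEnergy_sub_le`),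
`∫₀ᵗα³ ≤ M^{1/2}∫₀ᵗα²`, into `C₂ν∫₀ᵗα²` with `C₂ = 2C(2 + K⁴ + KM^{1/2}ν⁻¹)`, and
`γ(∫m²α²)^{1/2} ≤ ηγ² + η⁻¹∫m²α²` (`young_half`).

## Mathlib / tree search

Tree (reused, `lean search 'cylinder_cube|young_half|ulocEnergy_sub_le|denseSeq'`):
`exists_lintegral_cylinder_cube_le`, `young_half` (`UlocCubicInterpolation`); `ulocEnergy`,
`ulocGradEnergyOn`, `ulocEnergy_le`, `exists_ae_ulocEnergy_sub_le`,
`local_leray_difference_energy_estimate` (`LocalLerayWeakStrongProofs`). Mathlib: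
`MeasureTheory.setLIntegral_iUnion_of_directed`, `ENNReal.iSup_add_iSup_of_monotone`,
`ENNReal.mul_iSup`, `TopologicalSpace.denseSeq`, `ae_all_iff`.

## References

* P. G. Lemarié-Rieusset, *The Navier–Stokes Problem in the 21st Century*, CRC Press 2016,
  doi:10.1201/b19556 (held copy, file pages): proof of Thm. 14.1, p. 494 (the interpolation
  with `∫α³`); **Thm. 14.7 and proof (pp. 514–518)**: the seven estimates and "we obtain"
  (p. 517), "and thus `max(α(t)², νγ(t)²) ≤ …`" (p. 518). [LemarieRieusset2016]
-/

noncomputable section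

open MeasureTheory TopologicalSpace Set Function Filter Topology Metric
open scoped ENNReal NNReal RealInnerProductSpace

namespace Literature.Analysis.FluidPDE

/-! ## From the centres of a dense sequence to every centre -/

/-- **Inner regularity of unit balls in the centre.** Let `f ≥ 0` on a separable metric measure
space `X`, `g ≥ 0` on `ℝ × X`, `I ⊆ ℝ`, `c, R ∈ [0, ∞]`. If
`∫_{B(dₙ,1)} f + c ∫∫_{I × B(dₙ,1)} g ≤ R` along a dense sequence `(dₙ)`, then the same holds at
every centre `x₀`: the balls `B(x₀, 1 - 1/(k+2))` exhaust `B(x₀,1)` and each lies in some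
`B(dₙ,1)`, and set lower integrals are continuous along directed unions
(`MeasureTheory.setLIntegral_iUnion_of_directed`; no measurability is needed). [folklore] -/
theorem lintegral_ball_add_le_of_denseSeq {X : Type*} [PseudoMetricSpace X] [SeparableSpace X]
    [Nonempty X] [MeasureSpace X] {f : X → ℝ≥0∞} {g : ℝ × X → ℝ≥0∞} {I : Set ℝ} {c R : ℝ≥0∞}
    (h : ∀ n : ℕ, (∫⁻ x in ball (denseSeq X n) 1, f x) +
      c * (∫⁻ z in I ×ˢ ball (denseSeq X n) 1, g z) ≤ R) (x₀ : X) :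
    (∫⁻ x in ball x₀ 1, f x) + c * (∫⁻ z in I ×ˢ ball x₀ 1, g z) ≤ R := by
  -- the exhaustion of the unit ball
  set r : ℕ → ℝ := fun k => 1 - 1 / ((k : ℝ) + 2) with hr
  have hrpos : ∀ k : ℕ, 0 < 1 / ((k : ℝ) + 2) := fun k => by positivity
  have hr_mono : Monotone r := fun k l hkl => by
    simp only [hr]
    have : (1 : ℝ) / ((l : ℝ) + 2) ≤ 1 / ((k : ℝ) + 2) :=
      one_div_le_one_div_of_le (by positivity) (by exact_mod_cast Nat.add_le_add_right hkl 2)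
    linarith
  set s : ℕ → Set X := fun k => ball x₀ (r k) with hs
  have hs_mono : Monotone s := fun k l hkl => ball_subset_ball (hr_mono hkl)
  have hs_dir : Directed (· ⊆ ·) s := hs_mono.directed_le
  have hsU : (⋃ k, s k) = ball x₀ 1 := by
    refine subset_antisymm (iUnion_subset fun k => ball_subset_ball (by
      simp only [hr]; linarith [hrpos k])) fun x hx => ?_
    rw [mem_ball] at hx
    obtain ⟨k, hk⟩ := exists_nat_one_div_lt (sub_pos.2 hx)
    refine mem_iUnion.2 ⟨k, mem_ball.2 ?_⟩
    have h1 : (1 : ℝ) / ((k : ℝ) + 2) ≤ 1 / ((k : ℝ) + 1) :=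
      one_div_le_one_div_of_le (by positivity) (by linarith)
    simp only [hr]
    linarith
  have hsU' : (⋃ k, I ×ˢ s k) = I ×ˢ ball x₀ 1 := by rw [← prod_iUnion, hsU]
  have hs_mono' : Monotone fun k => I ×ˢ s k := fun k l hkl => prod_mono Subset.rfl (hs_mono hkl)
  have hs_dir' : Directed (· ⊆ ·) fun k => I ×ˢ s k := hs_mono'.directed_le
  -- continuity from below of both integrals
  have e1 : ∫⁻ x in ball x₀ 1, f x = ⨆ k, ∫⁻ x in s k, f x := by
    rw [← hsU]; exact setLIntegral_iUnion_of_directed f hs_dir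
  have e2 : ∫⁻ z in I ×ˢ ball x₀ 1, g z = ⨆ k, ∫⁻ z in I ×ˢ s k, g z := by
    rw [← hsU']; exact setLIntegral_iUnion_of_directed g hs_dir'
  have m1 : Monotone fun k => ∫⁻ x in s k, f x := fun k l hkl => lintegral_mono_set (hs_mono hkl)
  have m2 : Monotone fun k => c * ∫⁻ z in I ×ˢ s k, g z := fun k l hkl =>
    mul_le_mul_right (lintegral_mono_set (prod_mono Subset.rfl (hs_mono hkl))) c
  rw [e1, e2, ENNReal.mul_iSup, ENNReal.iSup_add_iSup_of_monotone m1 m2]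
  refine iSup_le fun k => ?_
  -- the ball `B(x₀, r k)` lies in a unit ball centred at the dense sequence
  obtain ⟨n, hn⟩ := (denseRange_denseSeq X).exists_dist_lt x₀ (hrpos k)
  have hsub : s k ⊆ ball (denseSeq X n) 1 := by
    refine ball_subset_ball' ?_
    simp only [hr]
    linarith
  calc (∫⁻ x in s k, f x) + c * ∫⁻ z in I ×ˢ s k, g z
      ≤ (∫⁻ x in ball (denseSeq X n) 1, f x) + c * ∫⁻ z in I ×ˢ ball (denseSeq X n) 1, g z :=
        add_le_add (lintegral_mono_set hsub)
          (mul_le_mul_right (lintegral_mono_set (prod_mono Subset.rfl hsub)) c)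
    _ ≤ R := h n

/-! ## Two elementary inequalities in `ℝ≥0∞` -/

/-- `X ≤ 2 X` in `ℝ≥0∞`. [folklore] -/
theorem ennreal_le_two_mul_self (X : ℝ≥0∞) : X ≤ 2 * X := by
  calc X = 1 * X := (one_mul X).symm
    _ ≤ 2 * X := mul_le_mul_left one_le_two X

/-- **Young through the square roots**: `Γ^{1/2} I^{1/2} ≤ ηΓ + η⁻¹I` in `ℝ≥0∞` for `η > 0`
(the tree's `young_half` with `C = 1`; used for the printed
`C₀γ(t)(∫₀ᵗ‖u₃‖²_∞α²)^{1/2} ≤ C₁ηγ(t)² + C₁η⁻¹∫₀ᵗ‖u₃‖²_∞α²`, Lemarié-Rieusset 2016, p. 517).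
[folklore] -/
theorem rpow_half_mul_rpow_half_le {η : ℝ} (hη : 0 < η) (Γ I : ℝ≥0∞) :
    Γ ^ (1 / 2 : ℝ) * I ^ (1 / 2 : ℝ) ≤ ENNReal.ofReal η * Γ + ENNReal.ofReal η⁻¹ * I := by
  have h := young_half (a := Γ) (b := I) (C := 1) zero_le_one hη
  simpa only [ENNReal.ofReal_one, one_mul, one_pow] using h

/-! ## The assembly: the display of U₁ from the per-ball inequality -/

section Assembly

variable {ν T : ℝ} {u₀ : (EuclideanSpace ℝ (Fin 3)) → (EuclideanSpace ℝ (Fin 3))} {u₁ u₂ : ℝ → (EuclideanSpace ℝ (Fin 3)) → (EuclideanSpace ℝ (Fin 3))} {p₁ p₂ : ℝ → (EuclideanSpace ℝ (Fin 3)) → ℝ}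
  {G₁ G₂ : ℝ → (EuclideanSpace ℝ (Fin 3)) → (EuclideanSpace ℝ (Fin 3)) →L[ℝ] (EuclideanSpace ℝ (Fin 3))} {m : ℝ → ℝ} {ε : ℝ} {C : ℝ≥0}

/-- **The display "`max(α(t)², νγ(t)²) ≤ …`" of Lemarié-Rieusset 2016, p. 518, from the
per-ball inequality** (the two elementary steps of pp. 517–518 between the seven estimates and
the display, with the bookkeeping of the constants made explicit). Let `u₁, u₂` be local Leray
solutions on `(0,T) × ℝ³` (viscosity `ν > 0`, same datum) with weak spatial gradients `G₁, G₂`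
on the slab, `w = u₁ - u₂`, `α(s)² = ulocEnergy (w s)`, `γ(t)² = ulocGradEnergyOn t (G₁ - G₂)`,
`δ(t)³ = sup_y ∫₀ᵗ∫_{B(y,1)}|w|³`, and let `m`, `ε` be the majorants of `‖u₃(s)‖_∞`, `‖u₄‖`
(arbitrary here). **Hypothesis** (the sum of the seven estimates of p. 517, first line of the
display "we obtain", with one absolute constant `C`): for every centre `x₀` and a.e. `t ∈ (0,T)`,
`∫_{B(x₀,1)}|w(t)|² + ν∫₀ᵗ∫_{B(x₀,1)}|G₁ - G₂|² ≤ C(ν∫₀ᵗα² + δ(t)³ + ∫₀ᵗ m α² + γ(t)(∫₀ᵗm²α²)^{1/2}`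
`+ ε(∫₀ᵗα² + γ(t)²))`. **Conclusion**: there is `C₂ < ∞` such that for every `η > 0` and a.e.
`t ∈ (0,T)`,
`max(α(t)², νγ(t)²) ≤ C₂(ν∫₀ᵗα² + (∫₀ᵗα²)^{3/2} + η⁻³∫₀ᵗα⁶ + ∫₀ᵗmα² + η⁻¹∫₀ᵗm²α² + ηγ(t)²)`
`+ (C + 1)ε(∫₀ᵗα² + γ(t)²)`.
*Proof.* (i) The cubic term is interpolated on every unit cylinder,
`∫₀ᵗ∫_{B(y,1)}|w|³ ≤ K∫₀ᵗα³ + ηγ² + K⁴η⁻³∫₀ᵗα⁶` (`exists_lintegral_cylinder_cube_le`), the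
lower-order term `∫₀ᵗα³` — absent from the printed "`δ² ≤ C(∫α² + γ(∫α⁶)^{1/6})`" — being
absorbed in `C₂ν∫₀ᵗα²` through the a priori bound `α² ≤ M` a.e. (`exists_ae_ulocEnergy_sub_le`),
`∫₀ᵗα³ ≤ M^{1/2}∫₀ᵗα²`, `C₂ ≥ CKM^{1/2}ν⁻¹`; (ii) "for every `η > 0`, with constants that do not
depend on `η`": `γ(∫m²α²)^{1/2} ≤ ηγ² + η⁻¹∫m²α²` (`rpow_half_mul_rpow_half_le`); (iii) the
per-ball inequality, known for a.e. `t` simultaneously at all centres of a dense sequence, passes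
to every centre (`lintegral_ball_add_le_of_denseSeq`) and then to the suprema `α(t)²`, `νγ(t)²`.
The data-dependent constant is `C₂ = 2C(2 + K⁴ + KM^{1/2}ν⁻¹)`.
[cite: LemarieRieusset2016, Thm. 14.7, proof (file pp. 517–518: "Writing δ(t)² ≤ … we obtain (for every η > 0 …) … and thus max(α(t)², νγ(t)²) ≤ …")] -/
theorem exists_ae_max_ulocEnergy_le_of_forall_ball_le (hν : 0 < ν)
    (h₁ : IsLocalLeraySolutionOn T ν u₀ u₁ p₁) (h₂ : IsLocalLeraySolutionOn T ν u₀ u₂ p₂)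
    (hG₁ : HasWeakSpatialGradientOn (slab (EuclideanSpace ℝ (Fin 3)) (Ioo 0 T) isOpen_Ioo) u₁ G₁)
    (hG₂ : HasWeakSpatialGradientOn (slab (EuclideanSpace ℝ (Fin 3)) (Ioo 0 T) isOpen_Ioo) u₂ G₂)
    (hball : ∀ x₀ : (EuclideanSpace ℝ (Fin 3)), ∀ᵐ t ∂(volume.restrict (Ioo 0 T)),
      (∫⁻ x in ball x₀ 1, ‖(u₁ t - u₂ t) x‖ₑ ^ 2) +
        ENNReal.ofReal ν *
          (∫⁻ z in Ioo 0 t ×ˢ ball x₀ 1, ENNReal.ofReal (frobeniusNormSq ((G₁ - G₂) z.1 z.2))) ≤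
      C * (ENNReal.ofReal ν * (∫⁻ s in Ioo 0 t, ulocEnergy (u₁ s - u₂ s)) +
          (⨆ y : (EuclideanSpace ℝ (Fin 3)), ∫⁻ z in Ioo 0 t ×ˢ ball y 1, ‖u₁ z.1 z.2 - u₂ z.1 z.2‖ₑ ^ 3) +
          (∫⁻ s in Ioo 0 t, ENNReal.ofReal (m s) * ulocEnergy (u₁ s - u₂ s)) +
          ulocGradEnergyOn t (G₁ - G₂) ^ (1 / 2 : ℝ) *
            (∫⁻ s in Ioo 0 t, ENNReal.ofReal (m s ^ 2) * ulocEnergy (u₁ s - u₂ s)) ^ (1 / 2 : ℝ) +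
          ENNReal.ofReal ε *
            ((∫⁻ s in Ioo 0 t, ulocEnergy (u₁ s - u₂ s)) + ulocGradEnergyOn t (G₁ - G₂)))) :
    ∃ C₂ : ℝ≥0∞, C₂ ≠ ∞ ∧
    ∀ (η : ℝ), 0 < η →
    ∀ᵐ t ∂(volume.restrict (Ioo 0 T)),
      max (ulocEnergy (u₁ t - u₂ t)) (ENNReal.ofReal ν * ulocGradEnergyOn t (G₁ - G₂)) ≤
        C₂ * (ENNReal.ofReal ν * (∫⁻ s in Ioo 0 t, ulocEnergy (u₁ s - u₂ s)) +
            (∫⁻ s in Ioo 0 t, ulocEnergy (u₁ s - u₂ s)) ^ (3 / 2 : ℝ) +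
            ENNReal.ofReal (η⁻¹ ^ 3) * (∫⁻ s in Ioo 0 t, ulocEnergy (u₁ s - u₂ s) ^ 3) +
            (∫⁻ s in Ioo 0 t, ENNReal.ofReal (m s) * ulocEnergy (u₁ s - u₂ s)) +
            ENNReal.ofReal η⁻¹ *
              (∫⁻ s in Ioo 0 t, ENNReal.ofReal (m s ^ 2) * ulocEnergy (u₁ s - u₂ s)) +
            ENNReal.ofReal η * ulocGradEnergyOn t (G₁ - G₂)) +
        ENNReal.ofReal ((C : ℝ) + 1) * ENNReal.ofReal ε *
          ((∫⁻ s in Ioo 0 t, ulocEnergy (u₁ s - u₂ s)) + ulocGradEnergyOn t (G₁ - G₂)) := by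
  -- the cubic interpolation constant and the a priori bound `α² ≤ M` a.e.
  obtain ⟨K, hK0, hK⟩ := exists_lintegral_cylinder_cube_le
  obtain ⟨M, hMtop, hM⟩ := exists_ae_ulocEnergy_sub_le h₁ h₂
  -- constants
  have hν0 : ENNReal.ofReal ν ≠ 0 := (ENNReal.ofReal_pos.2 hν).ne'
  have hνtop : ENNReal.ofReal ν ≠ ∞ := ENNReal.ofReal_ne_top
  have hM12 : M ^ (1 / 2 : ℝ) ≠ ∞ := ENNReal.rpow_ne_top_of_nonneg (by norm_num) hMtop
  set K₁ : ℝ≥0∞ := ENNReal.ofReal K with hK₁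
  set K₄ : ℝ≥0∞ := ENNReal.ofReal (K ^ 4) with hK₄
  set L : ℝ≥0∞ := 2 + K₄ + K₁ * M ^ (1 / 2 : ℝ) * (ENNReal.ofReal ν)⁻¹ with hL
  have hLtop : L ≠ ∞ := by
    have : (ENNReal.ofReal ν)⁻¹ ≠ ∞ := ENNReal.inv_ne_top.2 hν0
    simp only [hL, hK₁, hK₄]
    finiteness
  have hL1 : 1 ≤ L := by
    simp only [hL]
    calc (1 : ℝ≥0∞) ≤ 2 := one_le_two
      _ ≤ 2 + K₄ + K₁ * M ^ (1 / 2 : ℝ) * (ENNReal.ofReal ν)⁻¹ := le_add_right le_self_add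
  have hL4 : K₄ ≤ L := by
    simp only [hL]
    exact le_add_right le_add_self
  have hLM : K₁ * M ^ (1 / 2 : ℝ) * (ENNReal.ofReal ν)⁻¹ ≤ L := by
    simp only [hL]; exact le_add_self
  refine ⟨2 * C * L, by finiteness, fun η hη => ?_⟩
  -- Step 1: for a.e. `t`, the per-ball inequality at every centre of a dense sequence
  have hae := ae_all_iff.2 fun n : ℕ => hball (denseSeq (EuclideanSpace ℝ (Fin 3)) n)
  filter_upwards [hae, ae_restrict_mem measurableSet_Ioo] with t ht htT
  -- abbreviations
  set A : ℝ → ℝ≥0∞ := fun s => ulocEnergy (u₁ s - u₂ s) with hA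
  set I₂ : ℝ≥0∞ := ∫⁻ s in Ioo 0 t, A s with hI₂
  set I₃ : ℝ≥0∞ := ∫⁻ s in Ioo 0 t, A s ^ 3 with hI₃
  set Im : ℝ≥0∞ := ∫⁻ s in Ioo 0 t, ENNReal.ofReal (m s) * A s with hIm
  set Im2 : ℝ≥0∞ := ∫⁻ s in Ioo 0 t, ENNReal.ofReal (m s ^ 2) * A s with hIm2
  set D : ℝ≥0∞ := ⨆ y : (EuclideanSpace ℝ (Fin 3)), ∫⁻ z in Ioo 0 t ×ˢ ball y 1, ‖u₁ z.1 z.2 - u₂ z.1 z.2‖ₑ ^ 3 with hD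
  set Γ : ℝ≥0∞ := ulocGradEnergyOn t (G₁ - G₂) with hΓ
  set R : ℝ≥0∞ := C * (ENNReal.ofReal ν * I₂ + D + Im + Γ ^ (1 / 2 : ℝ) * Im2 ^ (1 / 2 : ℝ) +
    ENNReal.ofReal ε * (I₂ + Γ)) with hR
  -- Step 2: the per-ball inequality at every centre, and the suprema
  have hball' : ∀ x₀ : (EuclideanSpace ℝ (Fin 3)), (∫⁻ x in ball x₀ 1, ‖(u₁ t - u₂ t) x‖ₑ ^ 2) +
      ENNReal.ofReal ν * (∫⁻ z in Ioo 0 t ×ˢ ball x₀ 1,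
        ENNReal.ofReal (frobeniusNormSq ((G₁ - G₂) z.1 z.2))) ≤ R :=
    lintegral_ball_add_le_of_denseSeq (f := fun x => ‖(u₁ t - u₂ t) x‖ₑ ^ 2)
      (g := fun z : ℝ × (EuclideanSpace ℝ (Fin 3)) => ENNReal.ofReal (frobeniusNormSq ((G₁ - G₂) z.1 z.2))) ht
  have hmax : max (A t) (ENNReal.ofReal ν * Γ) ≤ R := by
    refine max_le (ulocEnergy_le fun x₀ => le_self_add.trans (hball' x₀)) ?_
    simp only [hΓ, ulocGradEnergyOn]
    rw [ENNReal.mul_iSup]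
    exact iSup_le fun x₀ => le_add_self.trans (hball' x₀)
  refine hmax.trans ?_
  -- Step 3: the cubic interpolation on every unit cylinder, and the a priori bound
  have hDK : D ≤ K₁ * (∫⁻ s in Ioo 0 t, A s ^ (3 / 2 : ℝ)) + ENNReal.ofReal η * Γ +
      ENNReal.ofReal (K ^ 4 * η⁻¹ ^ 3) * I₃ :=
    iSup_le fun y => hK hG₁ hG₂ t htT.2.le y η hη
  have hMt : ∀ᵐ s ∂(volume.restrict (Ioo 0 t)), A s ≤ M :=
    ae_restrict_of_ae_restrict_of_subset (Ioo_subset_Ioo_right htT.2.le) hM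
  have hI32 : ∫⁻ s in Ioo 0 t, A s ^ (3 / 2 : ℝ) ≤ M ^ (1 / 2 : ℝ) * I₂ := by
    calc ∫⁻ s in Ioo 0 t, A s ^ (3 / 2 : ℝ) ≤ ∫⁻ s in Ioo 0 t, M ^ (1 / 2 : ℝ) * A s := by
          refine lintegral_mono_ae (hMt.mono fun s hs => ?_)
          rw [show (3 / 2 : ℝ) = 1 / 2 + 1 by norm_num,
            ENNReal.rpow_add_of_nonneg _ _ (by norm_num) (by norm_num), ENNReal.rpow_one]
          exact mul_le_mul' (ENNReal.rpow_le_rpow hs (by norm_num)) le_rfl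
      _ = M ^ (1 / 2 : ℝ) * I₂ := lintegral_const_mul' _ _ hM12
  have hK4η : ENNReal.ofReal (K ^ 4 * η⁻¹ ^ 3) ≤ L * ENNReal.ofReal (η⁻¹ ^ 3) := by
    rw [ENNReal.ofReal_mul (by positivity)]
    exact mul_le_mul_left hL4 _
  -- Step 4: Young through the maximum for the `u₃`-cross term
  have hY2 : Γ ^ (1 / 2 : ℝ) * Im2 ^ (1 / 2 : ℝ) ≤
      ENNReal.ofReal η * Γ + ENNReal.ofReal η⁻¹ * Im2 :=
    rpow_half_mul_rpow_half_le hη Γ Im2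
  -- Step 5: bookkeeping
  have hν1 : (ENNReal.ofReal ν)⁻¹ * ENNReal.ofReal ν = 1 := ENNReal.inv_mul_cancel hν0 hνtop
  have T2 : (C : ℝ≥0∞) * D ≤ C * L * (ENNReal.ofReal ν * I₂) +
      C * L * (ENNReal.ofReal (η⁻¹ ^ 3) * I₃) + C * (ENNReal.ofReal η * Γ) := by
    have h1 : K₁ * (M ^ (1 / 2 : ℝ) * I₂) ≤ L * (ENNReal.ofReal ν * I₂) := by
      calc K₁ * (M ^ (1 / 2 : ℝ) * I₂)
          = K₁ * M ^ (1 / 2 : ℝ) * ((ENNReal.ofReal ν)⁻¹ * ENNReal.ofReal ν) * I₂ := by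
            rw [hν1]; ring
        _ = (K₁ * M ^ (1 / 2 : ℝ) * (ENNReal.ofReal ν)⁻¹) * (ENNReal.ofReal ν * I₂) := by ring
        _ ≤ L * (ENNReal.ofReal ν * I₂) := mul_le_mul_left hLM _
    calc (C : ℝ≥0∞) * D
        ≤ C * (K₁ * (∫⁻ s in Ioo 0 t, A s ^ (3 / 2 : ℝ)) + ENNReal.ofReal η * Γ +
            ENNReal.ofReal (K ^ 4 * η⁻¹ ^ 3) * I₃) := mul_le_mul_right hDK _
      _ ≤ C * (K₁ * (M ^ (1 / 2 : ℝ) * I₂) + ENNReal.ofReal η * Γ +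
            L * ENNReal.ofReal (η⁻¹ ^ 3) * I₃) := by gcongr
      _ ≤ C * (L * (ENNReal.ofReal ν * I₂) + ENNReal.ofReal η * Γ +
            L * ENNReal.ofReal (η⁻¹ ^ 3) * I₃) := by gcongr
      _ = C * L * (ENNReal.ofReal ν * I₂) +
            C * L * (ENNReal.ofReal (η⁻¹ ^ 3) * I₃) + C * (ENNReal.ofReal η * Γ) := by ring
  have T4 : (C : ℝ≥0∞) * (Γ ^ (1 / 2 : ℝ) * Im2 ^ (1 / 2 : ℝ)) ≤
      C * (ENNReal.ofReal η * Γ) + C * L * (ENNReal.ofReal η⁻¹ * Im2) := by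
    calc (C : ℝ≥0∞) * (Γ ^ (1 / 2 : ℝ) * Im2 ^ (1 / 2 : ℝ))
        ≤ C * (ENNReal.ofReal η * Γ + ENNReal.ofReal η⁻¹ * Im2) := mul_le_mul_right hY2 _
      _ = C * (ENNReal.ofReal η * Γ) + C * 1 * (ENNReal.ofReal η⁻¹ * Im2) := by ring
      _ ≤ C * (ENNReal.ofReal η * Γ) + C * L * (ENNReal.ofReal η⁻¹ * Im2) := by gcongr
  have T5 : (C : ℝ≥0∞) * (ENNReal.ofReal ε * (I₂ + Γ)) ≤
      ENNReal.ofReal ((C : ℝ) + 1) * ENNReal.ofReal ε * (I₂ + Γ) := by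
    rw [← mul_assoc]
    gcongr
    rw [← ENNReal.ofReal_coe_nnreal]
    exact ENNReal.ofReal_le_ofReal (by simp)
  have TΓ : (C : ℝ≥0∞) * (ENNReal.ofReal η * Γ) + C * (ENNReal.ofReal η * Γ) ≤
      C * L * (2 * (ENNReal.ofReal η * Γ)) := by
    calc (C : ℝ≥0∞) * (ENNReal.ofReal η * Γ) + C * (ENNReal.ofReal η * Γ)
        = C * 1 * (2 * (ENNReal.ofReal η * Γ)) := by ring
      _ ≤ C * L * (2 * (ENNReal.ofReal η * Γ)) := by gcongr
  -- the final chain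
  set X₁ : ℝ≥0∞ := ENNReal.ofReal ν * I₂ with hX₁
  set X₃ : ℝ≥0∞ := ENNReal.ofReal (η⁻¹ ^ 3) * I₃ with hX₃
  set X₅ : ℝ≥0∞ := ENNReal.ofReal η⁻¹ * Im2 with hX₅
  set X₆ : ℝ≥0∞ := ENNReal.ofReal η * Γ with hX₆
  set Eε : ℝ≥0∞ := ENNReal.ofReal ((C : ℝ) + 1) * ENNReal.ofReal ε * (I₂ + Γ) with hEε
  calc R = C * X₁ + C * D + C * Im + C * (Γ ^ (1 / 2 : ℝ) * Im2 ^ (1 / 2 : ℝ)) +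
        C * (ENNReal.ofReal ε * (I₂ + Γ)) := by
        simp only [hR, hX₁]; ring
    _ ≤ C * L * X₁ + (C * L * X₁ + C * L * X₃ + C * X₆) + C * L * Im +
        (C * X₆ + C * L * X₅) + Eε := by
        gcongr
        · exact le_mul_of_one_le_right (by simp) hL1
        · exact le_mul_of_one_le_right (by simp) hL1
    _ = C * L * (2 * X₁) + C * L * X₃ + C * L * Im + C * L * X₅ +
        ((C * X₆) + C * X₆) + Eε := by ring
    _ ≤ C * L * (2 * X₁) + C * L * (2 * X₃) + C * L * (2 * Im) + C * L * (2 * X₅) +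
        C * L * (2 * X₆) + Eε := by
        have e₃ : (C : ℝ≥0∞) * L * X₃ ≤ C * L * (2 * X₃) :=
          mul_le_mul_right (ennreal_le_two_mul_self _) _
        have e₄ : (C : ℝ≥0∞) * L * Im ≤ C * L * (2 * Im) :=
          mul_le_mul_right (ennreal_le_two_mul_self _) _
        have e₅ : (C : ℝ≥0∞) * L * X₅ ≤ C * L * (2 * X₅) :=
          mul_le_mul_right (ennreal_le_two_mul_self _) _
        exact add_le_add (add_le_add (add_le_add (add_le_add (add_le_add le_rfl e₃) e₄) e₅) TΓ)
          le_rfl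
    _ = 2 * C * L * (X₁ + X₃ + Im + X₅ + X₆) + Eε := by ring
    _ ≤ 2 * C * L * (X₁ + I₂ ^ (3 / 2 : ℝ) + X₃ + Im + X₅ + X₆) + Eε := by
        gcongr
        exact le_self_add
    _ = 2 * ↑C * L * (ENNReal.ofReal ν * (∫⁻ s in Ioo 0 t, ulocEnergy (u₁ s - u₂ s)) +
          (∫⁻ s in Ioo 0 t, ulocEnergy (u₁ s - u₂ s)) ^ (3 / 2 : ℝ) +
          ENNReal.ofReal (η⁻¹ ^ 3) * (∫⁻ s in Ioo 0 t, ulocEnergy (u₁ s - u₂ s) ^ 3) +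
          (∫⁻ s in Ioo 0 t, ENNReal.ofReal (m s) * ulocEnergy (u₁ s - u₂ s)) +
          ENNReal.ofReal η⁻¹ *
            (∫⁻ s in Ioo 0 t, ENNReal.ofReal (m s ^ 2) * ulocEnergy (u₁ s - u₂ s)) +
          ENNReal.ofReal η * ulocGradEnergyOn t (G₁ - G₂)) +
        ENNReal.ofReal ((C : ℝ) + 1) * ENNReal.ofReal ε *
          ((∫⁻ s in Ioo 0 t, ulocEnergy (u₁ s - u₂ s)) + ulocGradEnergyOn t (G₁ - G₂)) := by
        rfl

end Assembly

/-! ## U₁ from the per-ball inequality -/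

/-- **U₁ from the per-ball inequality asserted for all data of U₁** — the form in which steps
1–4 of the proof plan (module docstring of `LocalLerayWeakStrongProofs.lean`) deliver the seven
estimates of Lemarié-Rieusset 2016, p. 517: one absolute constant `C` such that, in the setting
of **U₁** (two local Leray solutions on `(0,T) × ℝ³` with the same `L²_uloc` datum,
`u₁ = u₃ + u₄` a.e. with `‖u₃(s)‖_∞ ≤ m(s)`, `m² ∈ L¹`, `‖u₄(t)‖₃ ≤ ε`, weak spatial gradients
with the uniformly local bounds), for every centre `x₀` and a.e. `t ∈ (0,T)`,
`∫_{B(x₀,1)}|w(t)|² + ν∫₀ᵗ∫_{B(x₀,1)}|G₁ - G₂|² ≤ C(ν∫₀ᵗα² + δ(t)³ + ∫₀ᵗmα² + γ(∫₀ᵗm²α²)^{1/2}`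
`+ ε(∫₀ᵗα² + γ²))`. Then **U₁** holds, with `C₁ = C + 1`
(`exists_ae_max_ulocEnergy_le_of_forall_ball_le`).
[cite: LemarieRieusset2016, Thm. 14.7, proof (file pp. 517–518)] -/
theorem local_leray_difference_energy_estimate_of_forall_ball
    (h : ∃ C : ℝ≥0,
      ∀ (ν T : ℝ), 0 < ν → 0 < T →
      ∀ (u₀ : (EuclideanSpace ℝ (Fin 3)) → (EuclideanSpace ℝ (Fin 3))), (∃ C : ℝ≥0, ∀ x₀ : (EuclideanSpace ℝ (Fin 3)), ∫⁻ x in ball x₀ 1, ‖u₀ x‖ₑ ^ 2 ≤ C) →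
        IsWeaklyDivFree u₀ →
      ∀ (u₁ u₂ : ℝ → (EuclideanSpace ℝ (Fin 3)) → (EuclideanSpace ℝ (Fin 3))) (p₁ p₂ : ℝ → (EuclideanSpace ℝ (Fin 3)) → ℝ),
        IsLocalLeraySolutionOn T ν u₀ u₁ p₁ → IsLocalLeraySolutionOn T ν u₀ u₂ p₂ →
      ∀ (u₃ u₄ : ℝ → (EuclideanSpace ℝ (Fin 3)) → (EuclideanSpace ℝ (Fin 3))),
        (uncurry u₁ =ᵐ[volume.restrict (Ioo 0 T ×ˢ (univ : Set (EuclideanSpace ℝ (Fin 3))))]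
          fun z => u₃ z.1 z.2 + u₄ z.1 z.2) →
        AEStronglyMeasurable (uncurry u₃) (volume.restrict (Ioo 0 T ×ˢ (univ : Set (EuclideanSpace ℝ (Fin 3))))) →
      ∀ (m : ℝ → ℝ), IntegrableOn (fun t => m t ^ 2) (Ioo 0 T) volume →
        (∀ᵐ t ∂(volume.restrict (Ioo 0 T)), eLpNorm (u₃ t) ∞ volume ≤ ENNReal.ofReal (m t)) →
      ∀ (ε : ℝ), 0 ≤ ε →
        (∀ᵐ t ∂(volume.restrict (Ioo 0 T)), eLpNorm (u₄ t) 3 volume ≤ ENNReal.ofReal ε) →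
      ∀ (G₁ G₂ : ℝ → (EuclideanSpace ℝ (Fin 3)) → (EuclideanSpace ℝ (Fin 3)) →L[ℝ] (EuclideanSpace ℝ (Fin 3))),
        HasWeakSpatialGradientOn (slab (EuclideanSpace ℝ (Fin 3)) (Ioo 0 T) isOpen_Ioo) u₁ G₁ →
        HasWeakSpatialGradientOn (slab (EuclideanSpace ℝ (Fin 3)) (Ioo 0 T) isOpen_Ioo) u₂ G₂ →
        (∀ R : ℝ, 0 < R → ∃ C : ℝ≥0, ∀ x₀ : (EuclideanSpace ℝ (Fin 3)),
          ∫⁻ z in Ioo 0 T ×ˢ ball x₀ R, ENNReal.ofReal (frobeniusNormSq (G₁ z.1 z.2)) ≤ C) →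
        (∀ R : ℝ, 0 < R → ∃ C : ℝ≥0, ∀ x₀ : (EuclideanSpace ℝ (Fin 3)),
          ∫⁻ z in Ioo 0 T ×ˢ ball x₀ R, ENNReal.ofReal (frobeniusNormSq (G₂ z.1 z.2)) ≤ C) →
      ∀ x₀ : (EuclideanSpace ℝ (Fin 3)), ∀ᵐ t ∂(volume.restrict (Ioo 0 T)),
        (∫⁻ x in ball x₀ 1, ‖(u₁ t - u₂ t) x‖ₑ ^ 2) +
          ENNReal.ofReal ν *
            (∫⁻ z in Ioo 0 t ×ˢ ball x₀ 1, ENNReal.ofReal (frobeniusNormSq ((G₁ - G₂) z.1 z.2))) ≤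
        C * (ENNReal.ofReal ν * (∫⁻ s in Ioo 0 t, ulocEnergy (u₁ s - u₂ s)) +
            (⨆ y : (EuclideanSpace ℝ (Fin 3)), ∫⁻ z in Ioo 0 t ×ˢ ball y 1, ‖u₁ z.1 z.2 - u₂ z.1 z.2‖ₑ ^ 3) +
            (∫⁻ s in Ioo 0 t, ENNReal.ofReal (m s) * ulocEnergy (u₁ s - u₂ s)) +
            ulocGradEnergyOn t (G₁ - G₂) ^ (1 / 2 : ℝ) *
              (∫⁻ s in Ioo 0 t, ENNReal.ofReal (m s ^ 2) * ulocEnergy (u₁ s - u₂ s)) ^ (1 / 2 : ℝ) +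
            ENNReal.ofReal ε *
              ((∫⁻ s in Ioo 0 t, ulocEnergy (u₁ s - u₂ s)) + ulocGradEnergyOn t (G₁ - G₂)))) :
    local_leray_difference_energy_estimate := by
  obtain ⟨C, hC⟩ := h
  refine ⟨(C : ℝ) + 1, by positivity, ?_⟩
  intro ν T hν hT u₀ hu₀ hdiv u₁ u₂ p₁ p₂ h₁ h₂ u₃ u₄ hsplit hmeas₃ m hm hm₃ ε hε hε₄ G₁ G₂ hG₁ hG₂
    hG₁b hG₂b
  exact exists_ae_max_ulocEnergy_le_of_forall_ball_le hν h₁ h₂ hG₁ hG₂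
    (hC ν T hν hT u₀ hu₀ hdiv u₁ u₂ p₁ p₂ h₁ h₂ u₃ u₄ hsplit hmeas₃ m hm hm₃ ε hε hε₄ G₁ G₂ hG₁ hG₂
      hG₁b hG₂b)

end Literature.Analysis.FluidPDE
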